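import Summits.QuantumAdvantage.AdviceFreeQNC0.WalkCoordinates
import Summits.QuantumAdvantage.AdviceFreeQNC0.Elimination
import Summits.QuantumAdvantage.AdviceFreeQNC0.AdviceFreeQNC0
import Mathlib.Algebra.Field.ZMod
import HarnessLib

/-!
# Cell qa-qnc0 — transport: hardness of the walk game gives `RingHard 2` (`stub_transport`, all `n`)

Both registered lines (`product`, `tensor`) of the route crux `RingToElim`
(`Summits/QuantumAdvantage/QuantumAdvantage/Theses/RingFrame.lean`) end with the shared stub

  `stub_transport : RingHardU → RingHard 2`   ("trace-form dictionary ring ↔ walk at charge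
  `n + 2`; `θ = (1 + θ')/2`"),

where `RingHardU` (planner qa-qnc0-p2) says: every walk strategy `y : Fin (n+1) → ({0,1}ⁿ → Bool)`
of `𝔽₂`-degree `≤ (log₂ n)^C` WINS — `#{g : y_g(u) ∧ n + 2 + g + |u| + |u_{<g}| ≢ 0 (3)}` odd — on
at most `θ'·2ⁿ` inputs `u`. This file PROVES that implication for all `n`, with `RingHardU`'s body
as an explicit hypothesis (`ringHard_two_of_walkHard`; the skeleton's own `RingHardU`,
`ringWinU`, `walkExp`, `wt`, `wtPrefix`, `HasDeg` are repeated here VERBATIM, so the stub is the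
one-liner `fun h => ringHard_two_of_walkHard h` once the line's definitions are in the tree).

Ingredients: the chart `u = uVec x` of the transposition class (`u_i = ⊕_{j≤i} ¬x_j`, inverse
`xOfU`, affine), the trace form `traceForm` (`WalkCoordinates.lean`, all `N`), composition of
low-degree polynomials with affine maps (`comp_mem_lowDeg_of_coord`), and the count of the even
class (`card_even_class_le` of `WalkCoordinates.lean`: at most `2ⁿ` patterns, where any strategy
may win).
-/

namespace Summit.QuantumAdvantage.AdviceFreeQNC0

open Finset Literature.Computability.QuantumComplexity Literature.Computability.QuantumComplexity.RingHLF
open Literature.Computability.MetaComplexity Literature.Computability.MetaComplexity.Smolensky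

/-! ### The walk game (planner qa-qnc0-p2; verbatim from the registered lines) -/

/-- prefix weight `W_g(u) = #{i < g : u_i = 1}`. -/
def wtPrefix {n : ℕ} (u : Fin n → Bool) (g : ℕ) : ℕ :=
  (univ.filter fun i : Fin n => i.val < g ∧ u i = true).card

/-- walk exponent `e_g(u) = W(u) + W_g(u)`. -/
def walkExp {n : ℕ} (u : Fin n → Bool) (g : ℕ) : ℕ := wt u + wtPrefix u g

/-- WIN of the ring game in walk coordinates (charge `c`). -/
def ringWinU {n : ℕ} (c : ℕ) (y : Fin (n + 1) → (Fin n → Bool) → Bool) (u : Fin n → Bool) : Bool :=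
  decide ((univ.filter fun g : Fin (n + 1) =>
    y g u = true ∧ (c + g.val + walkExp u g.val) % 3 ≠ 0).card % 2 = 1)

/-! ### Composition with coordinatewise degree-`1` maps preserves the degree filtration -/

/-- The constant `1` has degree `0 ≤ D`. -/
private theorem one_mem_lowDeg' {F : Type*} [Field F] {k : ℕ} (D : ℕ) :
    (1 : CubeFn F k) ∈ lowDeg F k D := by
  rw [← mono_empty]
  exact mono_mem_lowDeg (by simp)

/-- A product of `|S|` functions of degree `≤ 1` has degree `≤ |S|`. -/
private theorem prod_mem_lowDeg_card {F : Type*} [Field F] {k : ℕ} {ι : Type*} (S : Finset ι)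
    (f : ι → CubeFn F k) (hf : ∀ i ∈ S, f i ∈ lowDeg F k 1) :
    (∏ i ∈ S, f i) ∈ lowDeg F k S.card := by
  classical
  induction S using Finset.induction_on with
  | empty => rw [prod_empty, card_empty]; exact one_mem_lowDeg' 0
  | insert a S ha ih =>
    rw [prod_insert ha, card_insert_of_notMem ha, add_comm]
    exact mul_mem_lowDeg_add (hf a (mem_insert_self a S))
      (ih fun i hi => hf i (mem_insert_of_mem hi))

/-- **Composition lemma**: if every coordinate of `e : {0,1}ᵏ → {0,1}ᵐ` has an indicator of
degree `≤ 1` (e.g. an affine map over `𝔽₂`), then `P ↦ P ∘ e` maps `lowDeg F m D` into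
`lowDeg F k D`. -/
theorem comp_mem_lowDeg_of_coord {F : Type*} [Field F] {k m D : ℕ}
    (e : (Fin k → Bool) → (Fin m → Bool))
    (he : ∀ i, (fun u => if e u i = true then (1 : F) else 0) ∈ lowDeg F k 1) {P : CubeFn F m}
    (hP : P ∈ lowDeg F m D) : (fun u => P (e u)) ∈ lowDeg F k D := by
  rw [lowDeg_eq_span] at hP
  induction hP using Submodule.span_induction with
  | mem Q hQ =>
    obtain ⟨⟨S, hS⟩, rfl⟩ := hQ
    have heq : (fun u => mono F S (e u)) = ∏ i ∈ S, (fun u => if e u i = true then (1 : F) else 0) := by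
      funext u
      rw [Finset.prod_apply]
      rfl
    rw [heq]
    exact lowDeg_mono hS (prod_mem_lowDeg_card S _ fun i _ => he i)
  | zero => exact Submodule.zero_mem _
  | add Q R _ _ hQ hR =>
    have h : (fun x => (Q + R) (e x)) = (fun x => Q (e x)) + fun x => R (e x) := by
      funext x; rfl
    rw [h]
    exact Submodule.add_mem _ hQ hR
  | smul a Q _ hQ =>
    have h : (fun x => (a • Q) (e x)) = a • fun x => Q (e x) := by
      funext x; rfl
    rw [h]
    exact Submodule.smul_mem _ a hQ

/-! ### The chart of the transposition class -/

variable {n : ℕ}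

/-- The walk coordinates of a pattern of length `n + 1`: `u_i = uCoord x i`, `i < n`. -/
def uVec (x : Fin (n + 1) → Bool) : Fin n → Bool := fun i => uCoord x i.castSucc

/-- `u` extended by `u_n = 1` (the last coordinate on the transposition class). -/
def uExt (u : Fin n → Bool) (i : ℕ) : Bool := if h : i < n then u ⟨i, h⟩ else true

/-- The inverse chart: `x_j = ¬(u_j ⊕ u_{j-1})` (`u_{-1} = 0`, `u_n = 1`). -/
def xOfU (u : Fin n → Bool) (j : Fin (n + 1)) : Bool :=
  !(xor (uExt u j.val) (if j.val = 0 then false else uExt u (j.val - 1)))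

/-- `uExt (uVec x) i = zpar x (i+1)` for `i < n`. -/
theorem uExt_uVec (x : Fin (n + 1) → Bool) {i : ℕ} (hi : i < n) :
    uExt (uVec x) i = zpar x (i + 1) := by
  unfold uExt uVec
  rw [dif_pos hi, uCoord_eq_zpar]
  rfl

/-- **The chart is inverted by `xOfU`** on the transposition class. -/
theorem xOfU_uVec (hn : 2 ≤ n) (x : Fin (n + 1) → Bool)
    (hodd : (univ.filter fun j : Fin (n + 1) => x j = false).card % 2 = 1) :
    xOfU (uVec x) = x := by
  funext j
  unfold xOfU
  have hlast : zpar x (n + 1) = true := zpar_length_of_odd x hodd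
  by_cases hj0 : j.val = 0
  · rw [if_pos hj0, hj0, uExt_uVec x (by omega), zpar_succ x (by omega), zpar_zero]
    have : j = ⟨0, by omega⟩ := Fin.ext hj0
    rw [this]
    cases x ⟨0, by omega⟩ <;> rfl
  · rw [if_neg hj0]
    by_cases hjn : j.val < n
    · rw [uExt_uVec x hjn, uExt_uVec x (by omega), show j.val - 1 + 1 = j.val by omega,
        zpar_succ x j.isLt]
      have : (⟨j.val, j.isLt⟩ : Fin (n + 1)) = j := Fin.ext rfl
      rw [this]
      cases zpar x j.val <;> cases x j <;> rfl
    · have hjv : j.val = n := by omega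
      have hout : uExt (uVec x) j.val = true := by
        unfold uExt; rw [dif_neg (by omega)]
      rw [hout, uExt_uVec x (by omega), show j.val - 1 + 1 = n by omega]
      have hs := zpar_succ x (show n < n + 1 by omega)
      rw [hlast] at hs
      have : (⟨n, by omega⟩ : Fin (n + 1)) = j := Fin.ext hjv.symm
      rw [this] at hs
      revert hs
      cases zpar x n <;> cases x j <;> decide

/-- Counting through `castSucc`: a count over `Fin n` is the count over the first `n` elements of
`Fin (n+1)`. -/
private theorem card_filter_castSucc (p : Fin (n + 1) → Prop) [DecidablePred p] :
    (univ.filter fun i : Fin n => p i.castSucc).card =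
      (univ.filter fun i : Fin (n + 1) => i.val < n ∧ p i).card := by
  rw [← Finset.card_map Fin.castSuccEmb]
  congr 1
  ext i
  simp only [mem_map, mem_filter, mem_univ, true_and, Fin.castSuccEmb_apply]
  constructor
  · rintro ⟨a, ha, rfl⟩
    exact ⟨by simp, ha⟩
  · rintro ⟨hi, hp⟩
    refine ⟨⟨i.val, hi⟩, ?_, Fin.ext rfl⟩
    have : (⟨i.val, hi⟩ : Fin n).castSucc = i := Fin.ext rfl
    rw [this]; exact hp

/-- `W_g` in the chart: `wtPrefix (uVec x) g = Wk x g` for `g ≤ n`. -/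
theorem wtPrefix_uVec (x : Fin (n + 1) → Bool) {g : ℕ} (hg : g ≤ n) :
    wtPrefix (uVec x) g = Wk x g := by
  unfold wtPrefix Wk uVec
  have h0 : (univ.filter fun i : Fin n => i.val < g ∧ uCoord x i.castSucc = true) =
      univ.filter fun i : Fin n =>
        (fun j : Fin (n + 1) => j.val < g ∧ uCoord x j = true) i.castSucc := rfl
  rw [h0, card_filter_castSucc (fun i => i.val < g ∧ uCoord x i = true)]
  congr 1
  ext i
  simp only [mem_filter, mem_univ, true_and]
  constructor
  · rintro ⟨_, h⟩; exact h
  · rintro ⟨h1, h2⟩; exact ⟨by omega, h1, h2⟩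

/-- `W` in the chart: `wt (uVec x) = Wk x n`. -/
theorem wt_uVec (x : Fin (n + 1) → Bool) : wt (uVec x) = Wk x n := by
  unfold wt Wk uVec
  rw [card_filter_castSucc (fun i => uCoord x i = true)]

/-! ### Degrees in the chart -/

/-- Each coordinate of `uExt` has an indicator of degree `≤ 1`. -/
private theorem ind_uExt_mem (i : ℕ) :
    (fun u : Fin n → Bool => if uExt u i = true then (1 : ZMod 2) else 0) ∈ lowDeg (ZMod 2) n 1 := by
  by_cases hi : i < n
  · have : (fun u : Fin n → Bool => if uExt u i = true then (1 : ZMod 2) else 0) =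
        mono (ZMod 2) {⟨i, hi⟩} := by
      funext u
      rw [mono_apply]
      simp [uExt, hi]
    rw [this]
    exact mono_mem_lowDeg (by simp)
  · have : (fun u : Fin n → Bool => if uExt u i = true then (1 : ZMod 2) else 0) = 1 := by
      funext u
      simp [uExt, hi]
    rw [this]
    exact one_mem_lowDeg' 1

/-- **The inverse chart is affine**: every coordinate of `xOfU` has an indicator of degree `≤ 1`
over `𝔽₂` (`[¬(A ⊕ B)] = 1 + [A] + [B]`). -/
theorem ind_xOfU_mem (j : Fin (n + 1)) :
    (fun u : Fin n → Bool => if xOfU u j = true then (1 : ZMod 2) else 0) ∈ lowDeg (ZMod 2) n 1 := by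
  have key : ∀ A B : Bool, (if (!xor A B) = true then (1 : ZMod 2) else 0) =
      1 + (if A = true then 1 else 0) + (if B = true then 1 else 0) := by decide
  by_cases hj0 : j.val = 0
  · have heq : (fun u : Fin n → Bool => if xOfU u j = true then (1 : ZMod 2) else 0) =
        1 + fun u => if uExt u j.val = true then (1 : ZMod 2) else 0 := by
      funext u
      simp only [xOfU, hj0, if_true, Pi.add_apply, Pi.one_apply]
      rw [key]
      simp
    rw [heq]
    exact Submodule.add_mem _ (one_mem_lowDeg' 1) (ind_uExt_mem _)
  · have heq : (fun u : Fin n → Bool => if xOfU u j = true then (1 : ZMod 2) else 0) =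
        1 + (fun u => if uExt u j.val = true then (1 : ZMod 2) else 0) +
          fun u => if uExt u (j.val - 1) = true then (1 : ZMod 2) else 0 := by
      funext u
      simp only [xOfU, hj0, if_false, Pi.add_apply, Pi.one_apply]
      rw [key]
    rw [heq]
    exact Submodule.add_mem _ (Submodule.add_mem _ (one_mem_lowDeg' 1) (ind_uExt_mem _))
      (ind_uExt_mem _)

/-- **The transported strategy has the same degree** (`D ≥ 1`): for `P` of degree `≤ D` on the
ring, `u ↦ [P(xOfU u) = 1] ⊕ t(xOfU u)_g` has `𝔽₂`-degree `≤ D`. -/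
theorem hasDeg_transport {D : ℕ} (hD : 1 ≤ D) (P : CubeFn (ZMod 2) (n + 1))
    (hP : P ∈ lowDeg (ZMod 2) (n + 1) D) (g : Fin (n + 1)) :
    HasDeg (fun u : Fin n → Bool => xor (decide (P (xOfU u) = 1)) (tGuess (xOfU u) g)) D := by
  unfold HasDeg
  have key : ∀ (a : ZMod 2) (b : Bool),
      (if xor (decide (a = 1)) b = true then (1 : ZMod 2) else 0) =
        a + (if b = true then 1 else 0) := by decide
  have heq : (fun u : Fin n → Bool =>
        if xor (decide (P (xOfU u) = 1)) (tGuess (xOfU u) g) = true then (1 : ZMod 2) else 0) =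
      (fun u => P (xOfU u)) + fun u => if tGuess (xOfU u) g = true then (1 : ZMod 2) else 0 := by
    funext u
    rw [key]
    rfl
  rw [heq]
  refine Submodule.add_mem _ (comp_mem_lowDeg_of_coord xOfU ind_xOfU_mem hP) ?_
  exact lowDeg_mono hD (comp_mem_lowDeg_of_coord xOfU ind_xOfU_mem (tGuess_mem_lowDeg_one g))

/-! ### The ring relation in the chart -/

/-- **Ring ↔ walk**: on the transposition class, `Rel x z` holds iff the transported strategy
`y_g(u) = z(xOfU u)_g ⊕ t(xOfU u)_g` WINS the walk game at charge `n + 2` on `u = uVec x`. -/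
theorem rel_iff_ringWinU (hn : 2 ≤ n) (x : Fin (n + 1) → Bool)
    (hodd : (univ.filter fun j : Fin (n + 1) => x j = false).card % 2 = 1)
    (z : (Fin (n + 1) → Bool) → (Fin (n + 1) → Bool)) :
    Rel x (z x) ↔
      ringWinU (n + 2) (fun g u => xor (z (xOfU u) g) (tGuess (xOfU u) g)) (uVec x) = true := by
  rw [traceForm (by omega) x hodd (z x)]
  unfold ringWinU walkExp
  rw [decide_eq_true_eq]
  have hset : (univ.filter fun k : Fin (n + 1) =>
        xor (z x k) (tGuess x k) = true ∧ (k.val + (n + 1) + Wk x k.val + Wk x (n + 1 - 1)) % 3 ≠ 2) =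
      univ.filter fun g : Fin (n + 1) =>
        (fun g u => xor (z (xOfU u) g) (tGuess (xOfU u) g)) g (uVec x) = true ∧
          (n + 2 + g.val + (wt (uVec x) + wtPrefix (uVec x) g.val)) % 3 ≠ 0 := by
    ext g
    simp only [mem_filter, mem_univ, true_and, wtPrefix_uVec x (show g.val ≤ n by omega),
      wt_uVec, xOfU_uVec hn x hodd, show n + 1 - 1 = n from rfl]
    constructor
    · rintro ⟨h1, h2⟩; exact ⟨h1, by omega⟩
    · rintro ⟨h1, h2⟩; exact ⟨h1, by omega⟩
  rw [hset]

/-! ### The transport theorem -/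

/-- `log₂ (n+1) ≤ log₂ n + 1`. -/
private theorem log_succ_le (n : ℕ) : Nat.log 2 (n + 1) ≤ Nat.log 2 n + 1 := by
  have h : n + 1 ≤ 2 ^ (Nat.log 2 n + 1) := Nat.lt_pow_succ_log_self (by norm_num) n
  calc Nat.log 2 (n + 1) ≤ Nat.log 2 (2 ^ (Nat.log 2 n + 1)) := Nat.log_mono_right h
    _ = Nat.log 2 n + 1 := Nat.log_pow (by norm_num) _

/-- Degree bookkeeping: `(log₂ (n+1))^c ≤ (log₂ n)^(2c+1)` and `1 ≤ (log₂ n)^(2c+1)` for `n ≥ 4`. -/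
private theorem degree_bookkeeping {n : ℕ} (hn : 4 ≤ n) (c : ℕ) :
    (Nat.log 2 (n + 1)) ^ c ≤ (Nat.log 2 n) ^ (2 * c + 1) ∧ 1 ≤ (Nat.log 2 n) ^ (2 * c + 1) := by
  have hlog : 2 ≤ Nat.log 2 n := Nat.le_log_of_pow_le (by norm_num) (by omega)
  have h1 : Nat.log 2 (n + 1) ≤ Nat.log 2 n * Nat.log 2 n := by
    have := log_succ_le n
    nlinarith
  constructor
  · calc (Nat.log 2 (n + 1)) ^ c ≤ (Nat.log 2 n * Nat.log 2 n) ^ c := Nat.pow_le_pow_left h1 c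
      _ = (Nat.log 2 n) ^ (2 * c) := by rw [← pow_two, ← pow_mul]
      _ ≤ (Nat.log 2 n) ^ (2 * c + 1) := Nat.pow_le_pow_right (by omega) (by omega)
  · exact Nat.one_le_pow _ _ (by omega)

/-- **`stub_transport`, all `n`: hardness of the walk game at charge `n + 2` implies `RingHard 2`**
with `θ = (1 + θ')/2`. Given a ring strategy `P` (degree `≤ (log₂ N)^c`, `N = n + 1`), the walk
strategy `y_g(u) = [P_g(xOfU u) = 1] ⊕ t(xOfU u)_g` has degree `≤ (log₂ n)^(2c+1)` and wins at
`u = uVec x` exactly when `P` solves the ring relation at the odd-class pattern `x`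
(`rel_iff_ringWinU`); the even class contributes at most `2ⁿ`. -/
theorem ringHard_two_of_walkHard
    (h : ∃ θ : ℝ, θ < 1 ∧ ∀ C : ℕ, ∃ n₀ : ℕ, ∀ n ≥ n₀, ∀ y : Fin (n + 1) → (Fin n → Bool) → Bool,
      (∀ g, HasDeg (y g) ((Nat.log 2 n) ^ C)) →
        ((univ.filter fun u : Fin n → Bool => ringWinU (n + 2) y u = true).card : ℝ) ≤
          θ * (2 : ℝ) ^ n) :
    RingHard 2 := by
  classical
  obtain ⟨θ', hθ', hW⟩ := h
  refine ⟨(1 + θ') / 2, by linarith, fun c => ?_⟩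
  obtain ⟨n₀, hn₀⟩ := hW (2 * c + 1)
  refine ⟨max (n₀ + 1) 5, fun N hN P hP => ?_⟩
  obtain ⟨n, rfl⟩ : ∃ n, N = n + 1 := ⟨N - 1, by omega⟩
  have hn₀n : n₀ ≤ n := by have := le_max_left (n₀ + 1) 5; omega
  have hn4 : 4 ≤ n := by have := le_max_right (n₀ + 1) 5; omega
  -- the transported walk strategy and its degree
  set z : (Fin (n + 1) → Bool) → (Fin (n + 1) → Bool) := fun x i => decide (P i x = 1) with hz
  set y : Fin (n + 1) → (Fin n → Bool) → Bool :=
    fun g u => xor (z (xOfU u) g) (tGuess (xOfU u) g) with hy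
  obtain ⟨hdegle, hone⟩ := degree_bookkeeping hn4 c
  have hdeg : ∀ g, HasDeg (y g) ((Nat.log 2 n) ^ (2 * c + 1)) := by
    intro g
    have hPg : P g ∈ lowDeg (ZMod 2) (n + 1) ((Nat.log 2 n) ^ (2 * c + 1)) :=
      lowDeg_mono hdegle (hP g)
    exact hasDeg_transport hone (P g) hPg g
  have hwin := hn₀ n hn₀n y hdeg
  -- split the solved patterns by the parity of the number of zeros
  set Sx := univ.filter fun x : Fin (n + 1) → Bool => Rel x (z x) with hSx
  set OddZ : (Fin (n + 1) → Bool) → Prop := fun x =>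
    (univ.filter fun j : Fin (n + 1) => x j = false).card % 2 = 1 with hOddZ
  have hsplit : Sx.card = (Sx.filter OddZ).card + (Sx.filter fun x => ¬ OddZ x).card :=
    (Finset.card_filter_add_card_filter_not _).symm
  have heven : (Sx.filter fun x => ¬ OddZ x).card ≤ 2 ^ n := by
    refine le_trans (Finset.card_le_card ?_) card_even_class_le
    intro x hx
    rw [mem_filter] at hx ⊢
    exact ⟨mem_univ _, hx.2⟩
  have hodd : (Sx.filter OddZ).card ≤
      (univ.filter fun u : Fin n → Bool => ringWinU (n + 2) y u = true).card := by
    refine Finset.card_le_card_of_injOn uVec ?_ ?_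
    · intro x hx
      rw [Finset.mem_coe, mem_filter, hSx, mem_filter] at hx
      rw [Finset.mem_coe, mem_filter]
      exact ⟨mem_univ _, (rel_iff_ringWinU (by omega) x hx.2 z).1 hx.1.2⟩
    · intro x₁ hx₁ x₂ hx₂ h
      rw [Finset.mem_coe, mem_filter] at hx₁ hx₂
      rw [← xOfU_uVec (by omega) x₁ hx₁.2, ← xOfU_uVec (by omega) x₂ hx₂.2, h]
  -- arithmetic
  have hS : (Sx.card : ℝ) ≤ 2 ^ n + θ' * 2 ^ n := by
    have h1 : (Sx.card : ℝ) ≤ ((Sx.filter fun x => ¬ OddZ x).card : ℝ) + ((Sx.filter OddZ).card : ℝ) := by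
      rw [hsplit]; push_cast; linarith
    have h2 : ((Sx.filter fun x => ¬ OddZ x).card : ℝ) ≤ 2 ^ n := by exact_mod_cast heven
    have h3 : ((Sx.filter OddZ).card : ℝ) ≤ θ' * 2 ^ n := le_trans (by exact_mod_cast hodd) hwin
    linarith
  have hpow : (2 : ℝ) ^ (n + 1) = 2 * 2 ^ n := by ring
  calc (Sx.card : ℝ) ≤ 2 ^ n + θ' * 2 ^ n := hS
    _ = (1 + θ') / 2 * (2 : ℝ) ^ (n + 1) := by rw [hpow]; ring

end Summit.QuantumAdvantage.AdviceFreeQNC0
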